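import Summits.HodgeConjecture.HodgeCM.PerL34.LocTorusSplit_1

/-! PORT of `HodgeCM/PerL34/LocTorusSplit.lean` (HodgeCMPerL run 82) — part 2: continuation of `Summits.HodgeConjecture.HodgeCM.PerL34.LocTorusSplit_1` (split at a top-level declaration boundary by port_pkg.py; scope re-opened below; declarations unchanged). -/

-- port_pkg: scope re-opened for this part (file-level context, then the namespace/section stack open at the cut)
set_option autoImplicit false
noncomputable section
open Topology Filter Set Sum IsDedekindDomain NumberField
open Literature.NumberTheory Literature.NumberTheory.Automorphic
open scoped RestrictedProduct Classical
namespace HodgeCM.PerL34.IdelicTorusModel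
open IdelePlaces RestrictedRegroup RestrictedCutout
variable (K L : Type) [Field K] [Field L] [Algebra K L] [NumberField K] [NumberField L]
section split
variable {K L}
variable (σ : L ≃ₐ[K] L) {w : HeightOneSpectrum (𝓞 L)} {v : HeightOneSpectrum (𝓞 K)} (hwv : w.under (𝓞 K) = v)
variable [FiniteDimensional K L]
section equiv

variable [IsGalois K L] (h2 : ∀ τ : L ≃ₐ[K] L, τ = 1 ∨ τ = σ) (hw : σ • w ≠ w)

/-- (Ported verbatim from the HodgeCMPerL package; no docstring in the source.) -/
@[simp] theorem splitEquiv_apply (g : locTorus K L (inr v)) :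
    splitEquiv σ hwv h2 hw g = (g : FibGroup K L (inr v)) (fibW hwv) := rfl

/-- (Ported verbatim from the HodgeCMPerL package; no docstring in the source.) -/
@[simp] theorem coe_splitEquiv_symm_apply (y : (w.adicCompletion L)ˣ) :
    (((splitEquiv σ hwv h2 hw).symm y : locTorus K L (inr v)) : FibGroup K L (inr v)) = splitLift σ hwv y := rfl

/-- (Ported verbatim from the HodgeCMPerL package; no docstring in the source.) -/
theorem splitEquiv_symm_apply_w (y : (w.adicCompletion L)ˣ) :
    (((splitEquiv σ hwv h2 hw).symm y : locTorus K L (inr v)) : FibGroup K L (inr v)) (fibW hwv) = y :=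
  splitLift_apply_w σ hwv hw y

/-- (Ported verbatim from the HodgeCMPerL package; no docstring in the source.) -/
theorem splitEquiv_symm_apply_sw (y : (w.adicCompletion L)ˣ) :
    (((splitEquiv σ hwv h2 hw).symm y : locTorus K L (inr v)) : FibGroup K L (inr v)) (fibSW σ hwv) =
      (galAdicCompletionUnitsEquiv σ rfl y)⁻¹ :=
  splitLift_apply_sw σ hwv hw y

/-- The second coordinate of a point of `U_v` is determined by the first: `z_{σw} = σ(z_w)⁻¹`. -/
theorem apply_sw_eq (g : locTorus K L (inr v)) :
    (g : FibGroup K L (inr v)) (fibSW σ hwv) = (galAdicCompletionUnitsEquiv σ rfl (splitEquiv σ hwv h2 hw g))⁻¹ :=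
  (mem_locTorus_iff_of_split σ hwv h2 hw _).1 g.2

/-- **The level at a split place is `𝒪_wˣ`**: `g ∈ (Π_{u∣v} 𝒪_uˣ) ⊓ U_v ↔ g_w ∈ 𝒪_wˣ`. -/
theorem mem_inH_iff_of_split (g : locTorus K L (inr v)) :
    g ∈ inH (fun k => fibSubgroup (intUnits L) (pl K L) k) (locTorus K L) (inr v) ↔
      splitEquiv σ hwv h2 hw g ∈ intUnits L (inr w) := by
  rw [Subgroup.mem_subgroupOf, mem_fibSubgroup_iff]
  refine ⟨fun h => h (fibW hwv), fun h i => ?_⟩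
  rcases fib_cases σ hwv h2 i with rfl | rfl
  · exact h
  · rw [apply_sw_eq σ hwv h2 hw g]
    exact inv_mem ((galAdicCompletionUnitsEquiv_mem_intUnits_iff σ rfl _).2 h)

/-- The level at a split place as `Valued.v g_w = 1`. -/
theorem mem_inH_iff_valued_eq_one_of_split (g : locTorus K L (inr v)) :
    g ∈ inH (fun k => fibSubgroup (intUnits L) (pl K L) k) (locTorus K L) (inr v) ↔
      Valued.v ((splitEquiv σ hwv h2 hw g : (w.adicCompletion L)ˣ) : w.adicCompletion L) = 1 := by
  rw [mem_inH_iff_of_split σ hwv h2 hw, mem_intUnits_inr_iff_valued_eq_one]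

/-- The level at a split place as `‖g_w‖ = 1` (the shape of pv13-g3's END hypothesis `hτUB`). -/
theorem mem_inH_iff_norm_eq_one_of_split (g : locTorus K L (inr v)) :
    g ∈ inH (fun k => fibSubgroup (intUnits L) (pl K L) k) (locTorus K L) (inr v) ↔
      ‖((splitEquiv σ hwv h2 hw g : (w.adicCompletion L)ˣ) : w.adicCompletion L)‖ = 1 := by
  rw [mem_inH_iff_of_split σ hwv h2 hw, mem_intUnits_inr_iff_norm_eq_one]

/-- The level corresponds to `𝒪_wˣ` under `splitEquiv`, as an equality of subgroups of `L_wˣ`. -/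
theorem map_inH_splitEquiv :
    (inH (fun k => fibSubgroup (intUnits L) (pl K L) k) (locTorus K L) (inr v)).map
        (splitEquiv σ hwv h2 hw).toMonoidHom = intUnits L (inr w) := by
  ext y
  constructor
  · rintro ⟨g, hg, rfl⟩
    exact (mem_inH_iff_of_split σ hwv h2 hw g).1 hg
  · intro hy
    refine ⟨(splitEquiv σ hwv h2 hw).symm y, ?_, ContinuousMulEquiv.apply_symm_apply _ _⟩
    rw [SetLike.mem_coe, mem_inH_iff_of_split σ hwv h2 hw, ContinuousMulEquiv.apply_symm_apply]
    exact hy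

end equiv

/-! ## §7  The END binders `τ / ord / ϖ / ord_ϖ / ker_ord` at a split place for `G_v := locTorus K L v`

pv09-g4's `RallisAdicEnd.exists_compactDomain_theta_ne_zero_adic_all` (and pv13-g3's `SplitShells` ENDs) take,
at a split place `v`, an identification `τ v : G v ≃ₜ* F_vˣ` and place data `ord v : G v →* Multiplicative ℤ`,
`ϖ v : G v` with `ord v (ϖ v) = ofAdd 1` and `ord v g = 1 ↔ g ∈ B v`.  For the genuine local group these are
`splitEquiv` and the transport of the lineage's `IsUniformizer.ord` (`LocalFactors.DilationOrd`, pv09-g3) along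
it; a uniformizer `ϖ_w ∈ L_wˣ` exists by `LocalFactors.DilationModel.Adic.exists_isUniformizer` (pv07-g2). -/

section endBinders

open HodgeCM.PerL34.LocalFactors.DilationModel

attribute [local instance] LocalFactors.DilationModel.Adic.nontriviallyNormedField

variable [IsGalois K L] (h2 : ∀ τ : L ≃ₐ[K] L, τ = 1 ∨ τ = σ) (hw : σ • w ≠ w)
  {ϖ : (w.adicCompletion L)ˣ} (hϖ : IsUniformizer ϖ)

/-- `ord_v := ord_{ϖ_w} ∘ splitEquiv : U_v →* Multiplicative ℤ`. -/
def splitOrd : locTorus K L (inr v) →* Multiplicative ℤ :=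
  hϖ.ord.comp (splitEquiv σ hwv h2 hw).toMonoidHom

/-- (Ported verbatim from the HodgeCMPerL package; no docstring in the source.) -/
theorem splitOrd_apply (g : locTorus K L (inr v)) :
    splitOrd σ hwv h2 hw hϖ g = hϖ.ord (splitEquiv σ hwv h2 hw g) := rfl

/-- `ϖ_v := splitEquiv⁻¹ ϖ_w = (ϖ_w, σ(ϖ_w)⁻¹) ∈ U_v`. -/
def splitUnif (ϖ : (w.adicCompletion L)ˣ) : locTorus K L (inr v) := (splitEquiv σ hwv h2 hw).symm ϖ

/-- END binder `ord_ϖ`: `ord_v ϖ_v = 1 ∈ ℤ`. -/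
theorem splitOrd_splitUnif : splitOrd σ hwv h2 hw hϖ (splitUnif σ hwv h2 hw ϖ) = Multiplicative.ofAdd 1 := by
  rw [splitOrd_apply, splitUnif, ContinuousMulEquiv.apply_symm_apply, hϖ.ord_self]

/-- END binder `ker_ord`: `ord_v g = 1 ↔ g ∈ B_v` (the level `(Π_{u∣v} 𝒪_uˣ) ⊓ U_v`). -/
theorem splitOrd_eq_one_iff (g : locTorus K L (inr v)) :
    splitOrd σ hwv h2 hw hϖ g = 1 ↔ g ∈ inH (fun k => fibSubgroup (intUnits L) (pl K L) k) (locTorus K L) (inr v) := by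
  rw [splitOrd_apply, hϖ.ord_eq_one_iff, mem_inH_iff_norm_eq_one_of_split σ hwv h2 hw]

end endBinders

end split

/-! ## §6  The CM case: `K = L⁺`, `σ = c` -/

section CM

variable [IsCMField L]

example : IsGalois (maximalRealSubfield L) L := inferInstance

/-- For a CM field, `Aut(L/L⁺) = {1, c}` in the form used above (tree `univ_eq_pair_complexConj`). -/
theorem eq_one_or_eq_complexConj (τ : L ≃ₐ[maximalRealSubfield L] L) : τ = 1 ∨ τ = IsCMField.complexConj L := by
  have h := Finset.mem_univ τ
  rw [univ_eq_pair_complexConj L, Finset.mem_insert, Finset.mem_singleton] at h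
  exact h

end CM

end HodgeCM.PerL34.IdelicTorusModel

end
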